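import Literature.NumberTheory.EllipticCurves.PAdicBSD
import Literature.NumberTheory.EllipticCurves.LeadingTerm
import Literature.Barriers.BirchSwinnertonDyer.ExceptionalZero
import Summits.BirchSwinnertonDyer.BirchSwinnertonDyer.Theses.LeadingTerm
import HarnessLib

/-!
# `Rung_mult_selfaux_r0` — special-case witness (F3 / BC5) for the forward rung R9⁰′ (line `RungMultSelfAux`)

Sorry-free companion of `Lines/RungMultSelfAux.lean` on crux `LeadingTerm.KatoDivisibility`.
Contents: the graded family `RungMultR0 A` (rank-0 `p`-part of BSD at a multiplicative prime `p ≥ 3`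
under (irr) and an `A`-admissible auxiliary multiplicative prime at which `E[p]` is ramified); the floor
as a named fact `Skinner2016_thmC` (Skinner 2016 Thm. C, cite); the no-sorry SPECIALISATION: the rung
restricted to the floor's parameter `A p ℓ := (ℓ ≠ p)` IS the floor (`floor_iff_thmC`, definitional), it
follows from the named fact (`floor_of_thmC`), and the rung implies it (`floor_of_selfaux`,
monotonicity); and the SEMISTABLE DIVIDEND `semistableNoAux_of_selfaux`: from the named fact
`RibetAuxPrime` (Ribet level lowering + Tate-curve finiteness) the self-auxiliary rung already yields the
auxiliary-free statement for all semistable curves. The same-rung guard (floor ↛ rung by cheap tactics)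
and the BC2/BC3/BC4 probes are recorded in the planner folder (`bc/probes_fail.lean`, 19/19 failed as
required) and the BC7 verdicts in `bc/bc7_probe.out` (8/8 CLEAN).
-/

set_option linter.dupNamespace false
set_option autoImplicit false

noncomputable section

open scoped Classical

open CongruenceSubgroup WeierstrassCurve
open Literature.NumberTheory.EllipticCurves Literature.NumberTheory.EllipticCurves.ModularForms

namespace Summit.BirchSwinnertonDyer.BirchSwinnertonDyer.Cruxes.KatoDivisibility.RungMultSelfAux.Special

/-! ### The graded family: floor < rung < next rung -/

/-- The rank-`0` `p`-part of the BSD formula in the print shape of Skinner–Urban Thm. 2 (a) /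
Skinner 2016 Thm. C / the tree's bsd.S30: `L(E,1)/Ω_E` is a rational `q` with
`ord_p q = ord_p(#Ш · ∏ c_ℓ / #E(ℚ)_tors²)`. [folklore] -/
def PPartR0 (W : WeierstrassCurve ℚ) [W.IsElliptic] [W.IsGloballyMinimal] (p : ℕ) [Fact p.Prime] :
    Prop :=
  ∃ q : ℚ, W.entireLFunction 1 / (W.realPeriodRat : ℂ) = (q : ℂ) ∧
    padicValRat p q = (padicValNat p W.shaOrder : ℤ) + padicValNat p W.tamagawaProduct -
      2 * padicValNat p W.torsionOrder

/-- The graded family `R9⁰(A)`: rank-`0` `p`-part at a multiplicative prime `p ≥ 3` under (irr) and the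
existence of an `A`-ADMISSIBLE auxiliary multiplicative prime `ℓ` at which `E[p]` is ramified
(`p ∤ ord_ℓ(Δ_min)`, Tate). Antitone in `A`. Floor: `A p ℓ := ℓ ≠ p`; rung: `A := ⊤`. [folklore] -/
def RungMultR0 (A : ℕ → ℕ → Prop) : Prop :=
  ∀ (W : WeierstrassCurve ℚ) [W.IsElliptic] [W.IsGloballyMinimal] (p : ℕ) [Fact p.Prime],
    3 ≤ p → W.HasMultiplicativeReductionAtPrime p → W.HasIrreducibleModPGaloisRep p →
    (∃ ℓ : ℕ, ∃ _ : Fact ℓ.Prime, A p ℓ ∧ W.HasMultiplicativeReductionAtPrime ℓ ∧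
        ¬ p ∣ padicValInt ℓ W.minimalDiscriminantInt) →
    W.entireLFunction 1 ≠ 0 → Finite W.sha → PPartR0 W p

/-- **FLOOR (named fact, in print): Skinner 2016, Thm. C** — C. Skinner, *Multiplicative reduction
and the cyclotomic main conjecture for GL₂*, Pacific J. Math. 283 (2016) 171–200 = arXiv:1407.1093,
Thm. C (p. 3): "Let `E/ℚ` be an elliptic curve, `p ≥ 3` a prime of good ordinary or multiplicative
reduction; (i) `E[p]` is an irreducible `G_ℚ`-representation; (ii) there exists a prime `q ≠ p` of
multiplicative reduction such that `E[p]` is ramified at `q`. (a) If `L(E,1) ≠ 0`, then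
`|L(E,1)/Ω_E|_p⁻¹ = |#Ш(E) · ∏_ℓ c_ℓ(E)|_p⁻¹`." Transcribed exactly as the tree's bsd.S30
(`padicValRat_bsd_rank_zero`: Néron period `realPeriodRat` of the globally minimal `W`; `E[p]`
ramified at the multiplicative `q` iff `p ∤ ord_q(Δ_min)`; no torsion term in print because
`E(ℚ)[p] = 0` under (irr); `hfin` makes `shaOrder` an order), restricted to the multiplicative case
and WITHOUT the surjectivity binder (footnote p. 3: (irr)+(ram) suffice). [cite: Skinner2016PacificMC, Thm. C (a)] -/
def Skinner2016_thmC : Prop :=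
  ∀ (W : WeierstrassCurve ℚ) [W.IsElliptic] [W.IsGloballyMinimal] (p : ℕ) [Fact p.Prime]
    (_hp : 3 ≤ p) (_hmult : W.HasMultiplicativeReductionAtPrime p)
    (_hirr : W.HasIrreducibleModPGaloisRep p)
    (_haux : ∃ ℓ : ℕ, ∃ _ : Fact ℓ.Prime, ℓ ≠ p ∧ W.HasMultiplicativeReductionAtPrime ℓ ∧
        ¬ p ∣ padicValInt ℓ W.minimalDiscriminantInt)
    (_hL : W.entireLFunction 1 ≠ 0) (_hfin : Finite W.sha),
    ∃ q : ℚ, W.entireLFunction 1 / (W.realPeriodRat : ℂ) = (q : ℂ) ∧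
      padicValRat p q = (padicValNat p W.shaOrder : ℤ) + padicValNat p W.tamagawaProduct -
        2 * padicValNat p W.torsionOrder

/-- The floor as the `A p ℓ := ℓ ≠ p` member of the family. [folklore] -/
def Floor_mult_aux_r0 : Prop := RungMultR0 (fun p ℓ => ℓ ≠ p)

/-- **THE RUNG (deciding)** `R9⁰′`: rank-`0` `p`-part of BSD at a multiplicative prime `p ≥ 3` under
(irr) and (ram′) "some multiplicative `ℓ`, POSSIBLY `ℓ = p`, has `p ∤ ord_ℓ(Δ_min)`". One move above
Skinner 2016 Thm. C (the admissible auxiliary set grows from `ℓ ≠ p` to all `ℓ`). Not claimed in print. [folklore] -/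
def Rung_mult_selfaux_r0 : Prop := RungMultR0 (fun _ _ => True)

/-- **NEXT RUNG** `R9⁰`: no auxiliary hypothesis at all (the exact `p ‖ N` analogue of
Burungale–Castella–Skinner Cor. 1.3.1 without (im)). [folklore] -/
def Rung_mult_noaux_r0 : Prop :=
  ∀ (W : WeierstrassCurve ℚ) [W.IsElliptic] [W.IsGloballyMinimal] (p : ℕ) [Fact p.Prime],
    3 ≤ p → W.HasMultiplicativeReductionAtPrime p → W.HasIrreducibleModPGaloisRep p →
    W.entireLFunction 1 ≠ 0 → Finite W.sha → PPartR0 W p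

/-- The family is antitone in the admissibility predicate. [folklore] -/
theorem rungMultR0_anti {A B : ℕ → ℕ → Prop} (hAB : ∀ p ℓ, A p ℓ → B p ℓ) :
    RungMultR0 B → RungMultR0 A := by
  intro h W _ _ p _ hp hm hi haux hL hfin
  obtain ⟨ℓ, hℓ, hA, hmℓ, hv⟩ := haux
  exact h W p hp hm hi ⟨ℓ, hℓ, hAB p ℓ hA, hmℓ, hv⟩ hL hfin

/-- The floor member IS Skinner's Thm. C, definitionally. [folklore] -/
theorem floor_iff_thmC : Floor_mult_aux_r0 ↔ Skinner2016_thmC :=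
  ⟨fun h W _ _ p _ hp hm hi haux hL hfin => h W p hp hm hi haux hL hfin,
   fun h W _ _ p _ hp hm hi haux hL hfin => h W p hp hm hi haux hL hfin⟩

/-- **Witness (special case, F3)**: the rung restricted to the floor's parameter (`ℓ ≠ p`) is the
floor, and the floor follows from the named fact with no `sorry`. [folklore] -/
theorem floor_of_thmC (h : Skinner2016_thmC) : Floor_mult_aux_r0 := floor_iff_thmC.2 h

/-- The rung specialises to the floor (monotonicity). [folklore] -/
theorem floor_of_selfaux (h : Rung_mult_selfaux_r0) : Floor_mult_aux_r0 :=
  rungMultR0_anti (fun _ _ _ => trivial) h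

/-- The next rung implies the rung. [folklore] -/
theorem selfaux_of_noaux (h : Rung_mult_noaux_r0) : Rung_mult_selfaux_r0 :=
  fun W _ _ p _ hp hm hi _ hL hfin => h W p hp hm hi hL hfin

/-! ### Semistable curves: the self-auxiliary rung is already auxiliary-free -/

/-- `W` is semistable, phrased over the Tamagawa-file vocabulary: every prime dividing the minimal
discriminant is a prime of multiplicative reduction. [folklore] -/
def IsSemistableMin (W : WeierstrassCurve ℚ) [W.IsElliptic] [W.IsGloballyMinimal] : Prop :=
  ∀ (ℓ : ℕ) [Fact ℓ.Prime], (ℓ : ℤ) ∣ W.minimalDiscriminantInt → W.HasMultiplicativeReductionAtPrime ℓ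

/-- NAMED FACT (in print; Ribet's level-lowering theorem combined with the Tate-curve criterion "`E[p]` is
finite at a multiplicative `p` iff `p ∣ ord_p(Δ_min)`", exactly as used for `p ∤ N` in Castella 2018 §5 ¶1
and JSW17 §7): for a semistable `E/ℚ`, a prime `p ≥ 3` of multiplicative reduction with `E[p]` irreducible
and finite at `p`, some bad prime `ℓ ≠ p` has `E[p]` ramified at `ℓ` (`p ∤ ord_ℓ(Δ_min)`) — otherwise
`ρ̄_{E,p}` would be modular of weight 2 and level 1. [cite: Ribet1990, Thm. 1.1] -/
def RibetAuxPrime : Prop :=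
  ∀ (W : WeierstrassCurve ℚ) [W.IsElliptic] [W.IsGloballyMinimal] (p : ℕ) [Fact p.Prime],
    3 ≤ p → IsSemistableMin W → W.HasMultiplicativeReductionAtPrime p →
    W.HasIrreducibleModPGaloisRep p → p ∣ padicValInt p W.minimalDiscriminantInt →
    ∃ ℓ : ℕ, ∃ _ : Fact ℓ.Prime, ℓ ≠ p ∧ (ℓ : ℤ) ∣ W.minimalDiscriminantInt ∧
      ¬ p ∣ padicValInt ℓ W.minimalDiscriminantInt

/-- The AUXILIARY-FREE rank-0 `p`-part statement at a multiplicative `p ≥ 3` under (irr), for semistable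
curves (the semistable case of the next rung `Rung_mult_noaux_r0`). [folklore] -/
def SemistableNoAuxR0 : Prop :=
  ∀ (W : WeierstrassCurve ℚ) [W.IsElliptic] [W.IsGloballyMinimal] (p : ℕ) [Fact p.Prime],
    3 ≤ p → IsSemistableMin W → W.HasMultiplicativeReductionAtPrime p →
    W.HasIrreducibleModPGaloisRep p → W.entireLFunction 1 ≠ 0 → Finite W.sha → PPartR0 W p

/-- SEMISTABLE DIVIDEND (no `sorry`): the self-auxiliary rung plus Ribet's auxiliary prime give the
auxiliary-free statement for every semistable curve — either Skinner's `q ≠ p` exists, or `E[p]` is not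
finite at `p` and `ℓ = p` is an admissible auxiliary prime. [folklore] -/
theorem semistableNoAux_of_selfaux (hR : RibetAuxPrime) (h : Rung_mult_selfaux_r0) :
    SemistableNoAuxR0 := by
  intro W _ _ p _ hp hss hm hi hL hfin
  refine h W p hp hm hi ?_ hL hfin
  by_cases hfinite : p ∣ padicValInt p W.minimalDiscriminantInt
  · obtain ⟨ℓ, hℓ, -, hdiv, hram⟩ := hR W p hp hss hm hi hfinite
    exact ⟨ℓ, hℓ, trivial, @hss ℓ hℓ hdiv, hram⟩
  · exact ⟨p, inferInstance, trivial, hm, hfinite⟩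

/-- The semistable no-aux statement also follows (trivially) from the next rung. [folklore] -/
theorem semistableNoAux_of_noaux (h : Rung_mult_noaux_r0) : SemistableNoAuxR0 :=
  fun W _ _ p _ hp _ hm hi hL hfin => h W p hp hm hi hL hfin

end Summit.BirchSwinnertonDyer.BirchSwinnertonDyer.Cruxes.KatoDivisibility.RungMultSelfAux.Special

end
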